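import Mathlib

/-!
# U2-LF core — typed statement (hsemireg-semihom-2 g2)

HONEST FRAMING. Class-level algebra only (Newton identities for four formal Chern roots and a
norm-form condition). It types the algebraic core of the memo `NOBARE-U2LF-semihom2-g2.md` §4;
it is NOT a statement about sheaves, and nothing here is proved toward HC / HC_CM / HC_AV / №4 /
26512 / 18881 / H2. LP ≠ kernel, design ≠ sheaf.

Dictionary (memo §4): for a rank-4 locally free sheaf `V` on `E_i^8` whose Chern character is that
of an (A1)-clean virtual design on a ≤4-direction common-apex curve-defect alphabet, write
`c_k(V(-h)) = e_k·x^k` (`k ≤ 3`), `c_4(V(-h)) = e_4·x^4 - 6w`, `x = [Θ]`, `w` the real Weil class with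
minor `μ = a + b·i ∈ ℚ(i)`. Then `ch_k(V(-h)) = 0` for `k = 5,6,7,8` forces `p5 = p6 = p7 = 0` and
`a^2 + b^2 = 140·e_4·p4` (Newton polynomials below). `Core` says this has no solution with `μ ≠ 0`.
The memo proves `Core` by an exact computation (case `e₁ = 0` by hand: families B0/B1, B1 killed
7-adically; case `e₁ ≠ 0`: the resultant octic in `e₂` has no rational root). Only the polynomial
identities and the two easy sub-cases are kernel-checked here.
-/

namespace HsemiregSemihom2.U2LF

/-- Newton power sum `p₄` of four formal roots in the elementary symmetric functions `e₁..e₄`. -/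
def p4 (e₁ e₂ e₃ e₄ : ℚ) : ℚ := e₁^4 - 4*e₁^2*e₂ + 4*e₁*e₃ + 2*e₂^2 - 4*e₄
/-- Newton power sum `p₅`. -/
def p5 (e₁ e₂ e₃ e₄ : ℚ) : ℚ := e₁^5 - 5*e₁^3*e₂ + 5*e₁^2*e₃ + 5*e₁*e₂^2 - 5*e₁*e₄ - 5*e₂*e₃
/-- Newton power sum `p₆`. -/
def p6 (e₁ e₂ e₃ e₄ : ℚ) : ℚ :=
  e₁^6 - 6*e₁^4*e₂ + 6*e₁^3*e₃ + 9*e₁^2*e₂^2 - 6*e₁^2*e₄ - 12*e₁*e₂*e₃ - 2*e₂^3 + 6*e₂*e₄ + 3*e₃^2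
/-- Newton power sum `p₇`. -/
def p7 (e₁ e₂ e₃ e₄ : ℚ) : ℚ :=
  e₁^7 - 7*e₁^5*e₂ + 7*e₁^4*e₃ + 14*e₁^3*e₂^2 - 7*e₁^3*e₄ - 21*e₁^2*e₂*e₃ - 7*e₁*e₂^3
    + 14*e₁*e₂*e₄ + 7*e₁*e₃^2 + 7*e₂^2*e₃ - 7*e₃*e₄
/-- Newton power sum `p₈`. -/
def p8 (e₁ e₂ e₃ e₄ : ℚ) : ℚ :=
  e₁^8 - 8*e₁^6*e₂ + 8*e₁^5*e₃ + 20*e₁^4*e₂^2 - 8*e₁^4*e₄ - 32*e₁^3*e₂*e₃ - 16*e₁^2*e₂^3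
    + 24*e₁^2*e₂*e₄ + 12*e₁^2*e₃^2 + 24*e₁*e₂^2*e₃ - 16*e₁*e₃*e₄ + 2*e₂^4 - 8*e₂^2*e₄
    - 8*e₂*e₃^2 + 4*e₄^2

/-- Newton recursion at `k = 8` (four roots): on `{p5 = p6 = p7 = 0}` it gives `p8 = -e₄·p4`,
which is how `8!·p8 + 288·|μ|² = 0` becomes `|μ|² = 140·e₄·p4`. -/
theorem p8_step (e₁ e₂ e₃ e₄ : ℚ) :
    p8 e₁ e₂ e₃ e₄ = e₁ * p7 e₁ e₂ e₃ e₄ - e₂ * p6 e₁ e₂ e₃ e₄ + e₃ * p5 e₁ e₂ e₃ e₄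
      - e₄ * p4 e₁ e₂ e₃ e₄ := by
  unfold p4 p5 p6 p7 p8; ring

/-- U2-LF core (rank 4): the Chern data of a rank-4 l.f. realisation of a clean ≤4-direction
common-apex class forces the Weil minor `μ = a + b i` to vanish. Proved in the memo by exact
computation; stated here as a `Prop` (not proved in Lean). -/
def Core : Prop :=
  ∀ e₁ e₂ e₃ e₄ a b : ℚ,
    p5 e₁ e₂ e₃ e₄ = 0 → p6 e₁ e₂ e₃ e₄ = 0 → p7 e₁ e₂ e₃ e₄ = 0 →
      a^2 + b^2 = 140 * e₄ * p4 e₁ e₂ e₃ e₄ → a = 0 ∧ b = 0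

/-- Sub-case `e₁ = e₂ = 0` (family B0 of the memo): `p4 (0,0,e₃,e₄) = -4e₄`, so the norm
equation alone reads `a² + b² = -560·e₄² ≤ 0` and forces `μ = 0` (and `e₄ = 0`). -/
theorem core_B0 (e₃ e₄ a b : ℚ)
    (h : a^2 + b^2 = 140 * e₄ * p4 0 0 e₃ e₄) : a = 0 ∧ b = 0 := by
  unfold p4 at h
  have ha : a^2 = 0 := by nlinarith [sq_nonneg a, sq_nonneg b, sq_nonneg e₄]
  have hb : b^2 = 0 := by nlinarith [sq_nonneg a, sq_nonneg b, sq_nonneg e₄]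
  exact ⟨pow_eq_zero_iff (two_ne_zero) |>.mp ha, pow_eq_zero_iff (two_ne_zero) |>.mp hb⟩

/-- Sub-case `e₁ = 0, e₂ = 0` is B0; sub-case `e₁ = 0, e₃ = 0, e₂ ≠ 0` is family B1:
`(0, u, 0, u²/3)` satisfies the three Newton equations identically and has
`140·e₄·p4 = (280/9)·u⁴` — the memo kills it 7-adically (`v₇` odd; not formalised here). -/
theorem family_B1 (u : ℚ) :
    p5 0 u 0 (u^2/3) = 0 ∧ p6 0 u 0 (u^2/3) = 0 ∧ p7 0 u 0 (u^2/3) = 0 ∧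
      140 * (u^2/3) * p4 0 u 0 (u^2/3) = 280/9 * u^4 := by
  unfold p4 p5 p6 p7; refine ⟨by ring, by ring, by ring, by ring⟩

/-- In case `e₁ = 0` the equation `p5 = 0` reads `e₂·e₃ = 0` (the hand case split of the memo). -/
theorem p5_e1_zero (e₂ e₃ e₄ : ℚ) : p5 0 e₂ e₃ e₄ = -5 * (e₂ * e₃) := by
  unfold p5; ring

/-- In case `e₁ = 0, e₃ = 0` the equation `p6 = 0` reads `e₂·(3e₄ - e₂²) = 0`. -/
theorem p6_e1_e3_zero (e₂ e₄ : ℚ) : p6 0 e₂ 0 e₄ = 2 * e₂ * (3 * e₄ - e₂^2) := by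
  unfold p6; ring

end HsemiregSemihom2.U2LF
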